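import Mathlib
import Literature.Computability.Complexity.ConstantDepth
import Literature.Computability.Complexity.CircuitRestriction
import Literature.Computability.Complexity.TC0SubsetNC1Reduction
import Summits.QuantumAdvantage.QuantumAdvantage.Theorems.MobiusLadderLiouvilleOrthogonalTC0StubDepthOneLtf
import HarnessLib

/-!
# Crux `MobiusLadder.LiouvilleOrthogonalTC0` (stmt-QuantumAdvantage-1393), line `Sketch` (v7):
# stub `stub_constSubst` — replacing the majority gates of a `tcBasis` circuit by guessed constants

Registered stub `stub_constSubst` (lead `prover-line-stmt-QuantumAdvantage-1393-c4-0`, skeleton v7,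
rung "`AC⁰` circuits with `O(log n)` majority gates at the bottom"). Statement: for a circuit `C` on
`n` inputs over `tcBasis = {¬} ∪ {∧ₖ, ∨ₖ, MAJₖ}` and a guess `v : ℕ → Bool` of the values of its
gates, there is a circuit `C'` over `acBasis = {¬} ∪ {∧ₖ, ∨ₖ}` with `acDepth C' ≤ acDepth C`,
`|C'| ≤ |C|`, and `C' x = C x` at every input `x` at which `v j` is the value of gate `j` for every
MAJORITY gate `j` of `C`.

Construction (straight-line surgery, every gate keeps its position so that all wires stay valid):
gate `j` of the program `C.gates` is kept if it is not a majority gate (then it is a gate of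
`acBasis`), and is replaced by the wireless constant gate `GateList.constGate (v j)` (gate function
`GateFn.const (v j) = ∧₀ / ∨₀ ∈ acBasis`, `acWeight 1 = acWeight MAJₖ`) otherwise.

* `ConstSubst.getD_append_singleton_le` — bookkeeping: pointwise `≤` of two depth lists survives
  appending one compared entry;
* `ConstSubst.exists_subst` — the surgery on gate lists, by reverse induction on the program
  (`GateList.vals_append_singleton`, `GateList.wdepths_append_singleton`): the new program is well
  formed, over `acBasis`, of the same length, with pointwise no larger `acWeight`-depths, and with
  the same gate values at every input where the guess is right on the majority gates;
* `stub_constSubst` — the circuit, extracted by `ACRealOver.toCircuit` on the common output wire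
  (`GateList.circuit_eval`, `GateList.circuit_depthWith`).
-/

set_option linter.dupNamespace false -- D-0017: single-problem summit ⇒ `QuantumAdvantage.QuantumAdvantage` by design

namespace Summit.QuantumAdvantage.QuantumAdvantage.Theorems.LiouvilleOrthogonalTC0

open Finset
open Literature.Computability.Complexity
open Literature.Computability.Complexity.GateList

namespace ConstSubst

/-- Bookkeeping for depth lists: if `l ≤ l'` pointwise (as `getD · 0`), `|l| = |l'|` and `a ≤ b`,
then `l ++ [a] ≤ l' ++ [b]` pointwise. -/
theorem getD_append_singleton_le {l l' : List ℕ} (hlen : l.length = l'.length)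
    (h : ∀ j, l.getD j 0 ≤ l'.getD j 0) {a b : ℕ} (hab : a ≤ b) (j : ℕ) :
    (l ++ [a]).getD j 0 ≤ (l' ++ [b]).getD j 0 := by
  rcases lt_trichotomy j l.length with hj | rfl | hj
  · rw [List.getD_append _ _ _ _ hj, List.getD_append _ _ _ _ (hlen ▸ hj)]
    exact h j
  · rw [List.getD_append_right _ _ _ _ le_rfl, Nat.sub_self, List.getD_cons_zero, hlen,
      List.getD_append_right _ _ _ _ le_rfl, Nat.sub_self, List.getD_cons_zero]
    exact hab
  · rw [List.getD_eq_default _ _ (by simp; omega), List.getD_eq_default _ _ (by simp; omega)]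

/-- **The surgery on straight-line programs.** For a well-formed program `gs` over `tcBasis` on the
inputs `Fin n` and a guess `v`, there is a well-formed program `gs'` over `acBasis` of the same
length (gate `j` kept if it is not a majority gate, replaced by the constant gate `v j` otherwise)
whose `acWeight`-depths are pointwise at most those of `gs`, and whose gate values agree with those
of `gs` at every input `x` at which `v j` is the value of every majority gate `j` of `gs`. -/
theorem exists_subst {n : ℕ} (v : ℕ → Bool) (gs : List (Gate (Fin n))) (hwf : WF gs)
    (hB : ∀ g ∈ gs, g.fn ∈ tcBasis) :
    ∃ gs' : List (Gate (Fin n)), WF gs' ∧ (∀ g ∈ gs', g.fn ∈ acBasis) ∧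
      gs'.length = gs.length ∧
      (∀ j, (wdepths acWeight gs').getD j 0 ≤ (wdepths acWeight gs).getD j 0) ∧
      ∀ x : Fin n → Bool,
        (∀ (j : ℕ) (hj : j < gs.length), (∃ k, (gs[j]).fn = GateFn.maj k) →
          v j = (vals gs x).getD j false) →
        vals gs' x = vals gs x := by
  induction gs using List.reverseRecOn with
  | nil => exact ⟨[], WF.nil, by simp, rfl, fun j => le_rfl, fun x _ => rfl⟩
  | append_singleton gs g ih =>
    obtain ⟨gs', hwf', hB', hlen, hdep, hval⟩ :=
      ih hwf.of_append_left fun g' hg' => hB g' (List.mem_append_left _ hg')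
    have hgB : g.fn ∈ tcBasis := hB g (by simp)
    have hok : GateOK gs.length g := hwf.getLast
    have hlen' : (wdepths acWeight gs').length = (wdepths acWeight gs).length := by simp [hlen]
    -- the hypothesis on the guesses, restricted to the prefix `gs`
    have hres : ∀ x : Fin n → Bool,
        (∀ (j : ℕ) (hj : j < (gs ++ [g]).length), (∃ k, ((gs ++ [g])[j]).fn = GateFn.maj k) →
          v j = (vals (gs ++ [g]) x).getD j false) →
        ∀ (j : ℕ) (hj : j < gs.length), (∃ k, (gs[j]).fn = GateFn.maj k) →
          v j = (vals gs x).getD j false := by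
      intro x H j hj hmaj
      have hj' : j < (gs ++ [g]).length := by simp; omega
      have h1 := H j hj' (by rw [List.getElem_append_left hj]; exact hmaj)
      rw [h1, vals_append_singleton, List.getD_append _ _ _ _ (by simpa using hj)]
    by_cases hmaj : ∃ k, g.fn = GateFn.maj k
    · -- a majority gate: replaced by the guessed constant `v |gs|`
      refine ⟨gs' ++ [GateList.constGate (Fin n) (v gs.length)],
        hwf'.append_singleton (gateOK_constGate _ _), ?_, by simp [hlen], ?_, ?_⟩
      · intro g' hg'
        rw [List.mem_append, List.mem_singleton] at hg'
        rcases hg' with hg' | rfl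
        · exact hB' g' hg'
        · rw [GateList.constGate_fn]
          exact const_mem_acBasis _
      · rw [wdepths_append_singleton, wdepths_append_singleton]
        refine getD_append_singleton_le hlen' hdep ?_
        obtain ⟨k, hk⟩ := hmaj
        rw [GateList.constGate_fn, acWeight_const, hk, acWeight_maj]
        exact Nat.add_le_add_left ((Finset.sup_le fun a _ => a.elim0).trans (Nat.zero_le _)) 1
      · intro x H
        have hL : gs.length < (gs ++ [g]).length := by simp
        have h1 := H gs.length hL (by rw [List.getElem_concat_length rfl]; exact hmaj)
        rw [getD_vals_append_singleton] at h1
        rw [vals_append_singleton, vals_append_singleton, hval x (hres x H), ← h1]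
        rfl
    · -- a gate of `acBasis`: kept, at the same position
      have hgA : g.fn ∈ acBasis := by
        rcases hgB with h | h
        · exact h
        · obtain ⟨k, hk⟩ := Set.mem_iUnion.1 h
          rw [Set.mem_singleton_iff] at hk
          exact absurd ⟨k, hk⟩ hmaj
      refine ⟨gs' ++ [g], hwf'.append_singleton (hok.mono hlen.ge), ?_, by simp [hlen], ?_, ?_⟩
      · intro g' hg'
        rw [List.mem_append, List.mem_singleton] at hg'
        rcases hg' with hg' | rfl
        · exact hB' g' hg'
        · exact hgA
      · rw [wdepths_append_singleton, wdepths_append_singleton]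
        refine getD_append_singleton_le hlen' hdep ?_
        refine Nat.add_le_add_left (Finset.sup_mono_fun fun a _ => ?_) _
        cases g.args a with
        | inl i => rw [wireDepthOf_inl, wireDepthOf_inl]
        | inr m => rw [wireDepthOf_inr, wireDepthOf_inr]; exact hdep m
      · intro x H
        rw [vals_append_singleton, vals_append_singleton, hval x (hres x H)]

end ConstSubst

/-- **Registered stub `stub_constSubst`: constants for the majority gates.** Replacing every
majority gate of a `tcBasis` circuit `C` by the constant gate `∧₀` (true) / `∨₀` (false)
prescribed by the guess `v` gives a circuit `C'` over `acBasis` with `acDepth C' ≤ acDepth C`,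
`|C'| ≤ |C|`, which agrees with `C` at every input `x` at which `v` guesses the values of the
majority gates correctly (`ConstSubst.exists_subst` on `C.gates`, then `ACRealOver.toCircuit` on the
common output wire). -/
theorem stub_constSubst {n : ℕ} (C : Circuit (Fin n)) (hB : C.IsOver tcBasis) (v : ℕ → Bool) :
    ∃ C' : Circuit (Fin n), C'.IsOver acBasis ∧ C'.acDepth ≤ C.acDepth ∧ C'.size ≤ C.size ∧
      ∀ x : Fin n → Bool,
        (∀ (j : ℕ) (hj : j < C.gates.length), (∃ k, (C.gates[j]).fn = GateFn.maj k) →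
          v j = (GateList.vals C.gates x).getD j false) →
        C'.eval x = C.eval x := by
  obtain ⟨gs', hwf', hB', hlen, hdep, hval⟩ := ConstSubst.exists_subst v C.gates (wf_gates C) hB
  have ho : OutOK gs'.length C.output := fun m hm => by
    rw [hlen]
    exact C.wf_output m hm
  have hd : wireDepthOf (wdepths acWeight gs') C.output ≤ C.acDepth := by
    have h0 : C.acDepth = wireDepthOf (wdepths acWeight C.gates) C.output :=
      circuit_depthWith C acWeight
    rw [h0]
    cases C.output with
    | inl i => rw [wireDepthOf_inl, wireDepthOf_inl]
    | inr m => rw [wireDepthOf_inr, wireDepthOf_inr]; exact hdep m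
  have hreal : ACRealOver acBasis (fun x => wireOf x (vals gs' x) C.output) C.acDepth C.size :=
    ⟨gs', C.output, hwf', hB', ho, hlen.le, hd, fun x => rfl⟩
  obtain ⟨C', hO', hd', hs', hev'⟩ := hreal.toCircuit
  refine ⟨C', hO', hd', hs', fun x hx => ?_⟩
  rw [hev' x]
  show wireOf x (vals gs' x) C.output = C.eval x
  rw [circuit_eval, hval x hx]

end Summit.QuantumAdvantage.QuantumAdvantage.Theorems.LiouvilleOrthogonalTC0
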